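import Literature.MathematicalPhysics.QuantumFieldTheory.Balaban1983to89.B5Prop12GHolds

/-!
# `BalabanImbrieJaffe1984to88.BIJ85Prop12BridgeZero` — [BalabanImbrieJaffe1985] Sect. 7.2 p. 325 *"a consequence of Proposition 1.2 … of
[6I]"*, with [6I] = [Balaban1984PropagatorsI] Prop. 1.2 (1.110)–(1.111) p. 35: file 4 of the Prop. 1.2 FAMILY BRIDGE — THE SCALE `k = 0`
(`η = L⁰ = 1`), where the torus family of record of the tree's Proposition 1.2 (`B5ResidualGpTorusHolds.TopIdx`, `K ≥ 1`) has no member: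
the (1.110) entries `m = 0, 1` and the first (1.111) entry of r02's product setting `latticeSettingP12R 1 M a ·` DIRECTLY FROM (1.114).

statement-level skeleton of published theorems with citation tags; proofs where landed; nothing here is a claim about the Yang–Mills mass gap

CITATION HEADER (lean-in-tree rule).  Part of the lit-balaban TYPED SKELETON (HOME `run/shared/lean/pub/lit-balaban/`), Phase-2 proof seat p19
gen 6; rows B5.Prop1.2 (proved, owner r02) → C1.Eq7.2.1-7.2.2 / C1.Eq7.2.4 / C2.Eq2.16–2.19 (fold owner r15 free target HOME/STATUS
2026-08-21T20:16:20Z).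

THE PRINTED TEXT (verbatim, [6I] pp. 35–36 [PDF 19–20]): *"for arbitrary T_η, y, y′ ∈ T₁^{(k)} and J … |(GJ)(x)|, |(∇GJ)(x)|, … ≤
O(1)e^{−δ₀|y−y′|}|J| (1.110) … ‖ζ∇GJ‖_α, ‖ζG∇*J‖_α ≤ O(1)e^{−δ₀|y−y′|}(‖ζ‖_α + |ζ|)|J| (1.111) … Finally there exists a constant O(1)
such that ‖ζGJ‖, ‖ζ∇GJ‖, … ≤ O(1)e^{−δ₀|y−y′|}|ζ|‖J‖ (1.114) for supp ζ ⊂ Δ̃(y), supp J ⊂ Δ̃(y′)."*  At `η = 1` (`k = 0`, `T_η = T₁^{(0)}`,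
`Q₀ = 1`, `G = (Δ − ∂P∂* + a)⁻¹`) the cube `Δ̃(y′)` has at most `3^d` sites, so the (`η^d`-weighted = unweighted) localized `L²` norms of (1.114)
dominate the sup norms: (1.114) ⇒ (1.110), and the Hölder quotients of (1.109) run over pairs at distance exactly `1`, whence (1.111).

WHAT IS PROVED (generic dimension `d`, periods `M`, `a > 0`, the fine lattice `Tor (fine n M)` with `n = 1`; (1.114) for G is the tree's
HYPOTHESIS-FREE `B5Local114GLattice.l2locL_le_printed`, any `n ≥ 1`):
* §1 plumbing: pointwise values below `ℓ²` norms, the indicator cut-off of `Δ̃(y)`, `η^{d/2} = 1` and `‖J‖ ≤ √(d³3^d)|J|` at `η = 1`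
  (r02's located leaf `l2NormR_le_supNorm`);
* §2 **`eL_zero_le_one`, `eL_one_le_one`**: the (1.110) entries `m = 0, 1` of `latticeSettingP12R 1 M a ·` for EVERY real source
  (`O(1) = const114(d,a)·√(d³3^d)`, `δ₀ = delta114(d,a)`);
* §3 **`h1L_vec_le_one`**: the first (1.111) entry for real vector sources (`O(1)(α) = 2·const114(d,a)·√(d³3^d)`, every `α`).
File 5 `…BIJ85Prop12LevStd` feeds these (at `n = L⁰`) and the torus family of record (at `n = L^k`, `k ≥ 1`) into files 2–3.
HONEST SCOPE.  Elementary consequences of the PROVED (1.114) on a unit lattice; no Prop-valued definition, no new hypothesis.  The only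
definition is the indicator cut-off (with body).  Unit `lit-balaban-p19` (literature-prover-lit-balaban-p19-g6-0), 2026-08-21.
-/

namespace Literature.MathematicalPhysics.QuantumFieldTheory.BalabanImbrieJaffe1984to88.BIJ85Prop12BridgeZero

open Literature.MathematicalPhysics.QuantumFieldTheory.Balaban1983to89
open scoped BigOperators Matrix
open B5Prop11Plancherel (Tor fine)
open B5Prop11Lower (nsq)
open B5Prop11Lattice (grad l2 l2T)
open B5Prop11SettingModel (Loc189 locNorm)
open B5DeltaA169 (DeltaA)
open B5Prop12FieldsLattice (cdistF distU distSite toFine cubeT cubeB suppInL supNormL eL h1L l2locL cutInL cutSupL cutHL holderT smulV smulT)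
open B5SettingP12Real (LocR latticeSettingP12R)
open B5SettingP12Weighted (sqEta etaPow)
open B5Local114GLattice (delta114 const114 delta114_pos const114_pos l2locL_le_printed)
open LatticeNorms (supNorm norm_le_supNorm supNorm_le supNorm_nonneg holderSeminorm_le holderSeminorm_nonneg)

noncomputable section

variable {d : ℕ}

/-! ## §1  Plumbing at `η = 1` -/

section Plumbing

variable (n : ℕ) [NeZero n] (M : Fin d → ℕ) [∀ μ, NeZero (M μ)]

/-- `|u_i| ≤ ‖u‖` (a value below the `ℓ²` norm). [folklore] -/
private theorem norm_le_l2 {ι : Type*} [Fintype ι] (u : ι → ℂ) (i : ι) : ‖u i‖ ≤ l2 u := by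
  unfold l2
  refine Real.le_sqrt_of_sq_le ?_
  unfold nsq
  exact Finset.single_le_sum (f := fun j => ‖u j‖ ^ 2) (fun j _ => sq_nonneg _) (Finset.mem_univ i)

/-- `|F_s,i| ≤ ‖F‖` for a tensor field. [folklore] -/
private theorem norm_le_l2T {ι S : Type*} [Fintype ι] [Fintype S] (F : S → ι → ℂ) (s : S) (i : ι) : ‖F s i‖ ≤ l2T F := by
  unfold l2T
  refine Real.le_sqrt_of_sq_le ?_
  calc ‖F s i‖ ^ 2 ≤ nsq (F s) := by
        unfold nsq
        exact Finset.single_le_sum (f := fun j => ‖F s j‖ ^ 2) (fun j _ => sq_nonneg _) (Finset.mem_univ i)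
    _ ≤ ∑ s', nsq (F s') := Finset.single_le_sum (f := fun s' => nsq (F s')) (fun s' _ => B5Prop11Lower.nsq_nonneg _) (Finset.mem_univ s)

open Classical in
/-- the indicator cut-off of the cube `Δ̃(y)` (the lattice reading of a `ζ ∈ C₀^∞(Δ̃(y))` equal to `1` on the points of interest; at `η = 1`
the Hölder norm plays no role). [cite: Balaban1984PropagatorsI, Prop. 1.2 (1.114) p.36 («supp ζ ⊂ Δ̃(y)»)] -/
def indCut (y : Tor M) : Tor (fine n M) → ℝ := fun z => if z ∈ cubeT n M y then 1 else 0

/-- `supp 1_{Δ̃(y)} ⊂ Δ̃(y)`. [cite: Balaban1984PropagatorsI, Prop. 1.2 (1.114) p.36] -/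
theorem cutInL_indCut (y : Tor M) : cutInL n M (indCut n M y) y := by
  intro z hz
  by_contra h
  exact hz (by simp [indCut, h])

/-- `1_{Δ̃(y)} = 1` on `Δ̃(y)`. [cite: Balaban1984PropagatorsI, Prop. 1.2 (1.114) p.36] -/
theorem indCut_of_mem {y : Tor M} {z : Tor (fine n M)} (hz : z ∈ cubeT n M y) : indCut n M y z = 1 := by
  simp [indCut, hz]

/-- `|1_{Δ̃(y)}| ≤ 1`. [cite: Balaban1984PropagatorsI, Prop. 1.2 (1.114) p.36 (|ζ|)] -/
theorem cutSupL_indCut_le (y : Tor M) : cutSupL n M (indCut n M y) ≤ 1 :=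
  supNorm_le zero_le_one fun z _ => by
    unfold indCut
    split_ifs <;> simp

variable {n M}

/-- `η^{d/2} = 1` at `η = 1`. [cite: Balaban1984PropagatorsI, (1.21) p.21] -/
theorem sqEta_one (d : ℕ) : sqEta 1 d = 1 := by
  simp [sqEta, etaPow]

/-- **`‖J‖ ≤ √(d³3^d)|J|` at `η = 1`** for a source supported in a cube `Δ̃(y′)` (r02's located leaf `l2NormR_le_supNorm`; at `η = 1` the
weighted and unweighted `ℓ²` norms coincide). [cite: Balaban1984PropagatorsI, (1.132)/(1.133) p.39 with (1.108) p.35] -/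
theorem locNorm_le_supNormL (hn : n = 1) (a : ℝ) (J : LocR n M) {y' : Tor M} (hJ : suppInL n M J.emb y') :
    locNorm J.emb ≤ Real.sqrt ((d : ℝ) ^ 3 * 3 ^ d) * supNormL n M J.emb := by
  have h := B5SettingP12Real.l2NormR_le_supNorm M n a (by omega) 0 J y' hJ
  change sqEta n d * locNorm J.emb ≤ Real.sqrt ((d : ℝ) ^ 3 * 3 ^ d) * supNormL n M J.emb at h
  subst hn
  rwa [sqEta_one, one_mul] at h

end Plumbing

/-! ## §2  The sup members (1.110), `m = 0, 1`, at `η = 1` from (1.114) -/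

section Sup

variable {n : ℕ} [NeZero n] {M : Fin d → ℕ} [∀ μ, NeZero (M μ)] {a : ℝ}

/-- **THE (1.110)/(1.111) CONSTANT AT `η = 1`**: `O(1) = const114(d,a)·√(d³3^d)`. [cite: Balaban1984PropagatorsI, Prop. 1.2 (1.110) p.35, (1.114) p.36] -/
def constZero (d : ℕ) (a : ℝ) : ℝ := const114 d a * Real.sqrt ((d : ℝ) ^ 3 * 3 ^ d)

/-- `0 < O(1)` for `d ≥ 1`; `0 ≤ O(1)` always. [cite: Balaban1984PropagatorsI, Prop. 1.2 (1.110) p.35] -/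
theorem constZero_nonneg (d : ℕ) (a : ℝ) : 0 ≤ constZero d a := by
  unfold constZero
  have := const114_pos d a
  positivity

/-- **(1.110), `m = 0`, AT `η = 1` FOR EVERY REAL SOURCE**: `sup_{Δ̃(y)}|GJ| ≤ O(1)e^{−δ₀|y−y′|}|J|`, `supp J ⊂ Δ̃(y′)`, with
`O(1) = constZero d a`, `δ₀ = delta114 d a` — from (1.114), `m = 0`, with the indicator cut-off of `Δ̃(y)`.
[cite: Balaban1984PropagatorsI, Prop. 1.2 (1.110) p.35, (1.114) p.36] -/
theorem eL_zero_le_one (hn : n = 1) (ha : 0 < a) (J : LocR n M) (y y' : Tor M) (hJ : suppInL n M J.emb y') :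
    eL n M a 0 J.emb y ≤ constZero d a * Real.exp (-(delta114 d a * distSite M y y')) * supNormL n M J.emb := by
  have hRHS : 0 ≤ constZero d a * Real.exp (-(delta114 d a * distSite M y y')) * supNormL n M J.emb := by
    have := constZero_nonneg d a
    have := B5Prop12FieldsLattice.supNormL_nonneg (n := n) (M := M) J.emb
    positivity
  cases J with
  | vec Jr =>
      show eL n M a 0 (Loc189.vec fun b => (Jr b : ℂ)) y ≤ _
      rw [B5Prop12FieldsLattice.eL_zero_vec]
      refine supNorm_le hRHS fun b hb => ?_
      have hb1 : b.1 ∈ cubeT n M y := (Finset.mem_product.mp hb).1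
      -- the value is the value of the cut field, below its `ℓ²` norm = (1.114), m = 0
      have h1 : ‖((DeltaA n M a)⁻¹ *ᵥ fun b => (Jr b : ℂ)) b‖
          = ‖smulV n M (indCut n M y) ((DeltaA n M a)⁻¹ *ᵥ fun b => (Jr b : ℂ)) b‖ := by
        simp only [smulV, indCut_of_mem n M hb1, Complex.ofReal_one, one_mul]
      have h2 := norm_le_l2 (smulV n M (indCut n M y) ((DeltaA n M a)⁻¹ *ᵥ fun b => (Jr b : ℂ))) b
      have h3 := l2locL_le_printed n M (by omega) ha 0 (Loc189.vec fun b => (Jr b : ℂ)) (indCut n M y)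
        (cutInL_indCut n M y) hJ
      rw [B5Prop12FieldsLattice.l2locL_zero_vec] at h3
      have h4 := locNorm_le_supNormL (M := M) hn a (LocR.vec Jr) hJ
      have h5 := cutSupL_indCut_le n M y
      have hc := (const114_pos d a).le
      have hE : 0 ≤ Real.exp (-(delta114 d a * distSite M y y')) := (Real.exp_pos _).le
      have hsN : 0 ≤ supNormL n M (LocR.vec Jr : LocR n M).emb := B5Prop12FieldsLattice.supNormL_nonneg _
      rw [h1]
      calc ‖smulV n M (indCut n M y) ((DeltaA n M a)⁻¹ *ᵥ fun b => (Jr b : ℂ)) b‖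
          ≤ l2 (smulV n M (indCut n M y) ((DeltaA n M a)⁻¹ *ᵥ fun b => (Jr b : ℂ))) := h2
        _ ≤ const114 d a * Real.exp (-(delta114 d a * distSite M y y')) * cutSupL n M (indCut n M y)
              * locNorm (Loc189.vec fun b => (Jr b : ℂ)) := h3
        _ ≤ const114 d a * Real.exp (-(delta114 d a * distSite M y y')) * 1
              * (Real.sqrt ((d : ℝ) ^ 3 * 3 ^ d) * supNormL n M (LocR.vec Jr : LocR n M).emb) := by
            gcongr
            · exact B5Prop11SettingModel.locNorm_nonneg _
            · exact h4
        _ = constZero d a * Real.exp (-(delta114 d a * distSite M y y')) * supNormL n M (LocR.vec Jr : LocR n M).emb := by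
            unfold constZero; ring
  | ten Jr => exact hRHS
  | ten2 Jr => exact hRHS

/-- **(1.110), `m = 1`, AT `η = 1` FOR EVERY REAL SOURCE**: `sup_{Δ̃(y)}|∇GJ| ≤ O(1)e^{−δ₀|y−y′|}|J|`, `supp J ⊂ Δ̃(y′)` — from (1.114), `m = 1`.
[cite: Balaban1984PropagatorsI, Prop. 1.2 (1.110) p.35, (1.114) p.36] -/
theorem eL_one_le_one (hn : n = 1) (ha : 0 < a) (J : LocR n M) (y y' : Tor M) (hJ : suppInL n M J.emb y') :
    eL n M a 1 J.emb y ≤ constZero d a * Real.exp (-(delta114 d a * distSite M y y')) * supNormL n M J.emb := by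
  have hRHS : 0 ≤ constZero d a * Real.exp (-(delta114 d a * distSite M y y')) * supNormL n M J.emb := by
    have := constZero_nonneg d a
    have := B5Prop12FieldsLattice.supNormL_nonneg (n := n) (M := M) J.emb
    positivity
  cases J with
  | vec Jr =>
      show eL n M a 1 (Loc189.vec fun b => (Jr b : ℂ)) y ≤ _
      rw [B5Prop12FieldsLattice.eL_one_vec]
      refine supNorm_le hRHS fun p hp => ?_
      have hb1 : p.2.1 ∈ cubeT n M y := (Finset.mem_product.mp (Finset.mem_product.mp hp).2).1
      have h1 : ‖grad n M ((DeltaA n M a)⁻¹ *ᵥ fun b => (Jr b : ℂ)) p.1 p.2‖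
          = ‖smulT n M (indCut n M y) (grad n M ((DeltaA n M a)⁻¹ *ᵥ fun b => (Jr b : ℂ))) p.1 p.2‖ := by
        simp only [smulT, indCut_of_mem n M hb1, Complex.ofReal_one, one_mul]
      have h2 := norm_le_l2T (smulT n M (indCut n M y) (grad n M ((DeltaA n M a)⁻¹ *ᵥ fun b => (Jr b : ℂ)))) p.1 p.2
      have h3 := l2locL_le_printed n M (by omega) ha 1 (Loc189.vec fun b => (Jr b : ℂ)) (indCut n M y)
        (cutInL_indCut n M y) hJ
      rw [B5Prop12FieldsLattice.l2locL_one_vec] at h3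
      have h4 := locNorm_le_supNormL (M := M) hn a (LocR.vec Jr) hJ
      have h5 := cutSupL_indCut_le n M y
      have hc := (const114_pos d a).le
      have hE : 0 ≤ Real.exp (-(delta114 d a * distSite M y y')) := (Real.exp_pos _).le
      have hsN : 0 ≤ supNormL n M (LocR.vec Jr : LocR n M).emb := B5Prop12FieldsLattice.supNormL_nonneg _
      rw [h1]
      calc ‖smulT n M (indCut n M y) (grad n M ((DeltaA n M a)⁻¹ *ᵥ fun b => (Jr b : ℂ))) p.1 p.2‖
          ≤ l2T (smulT n M (indCut n M y) (grad n M ((DeltaA n M a)⁻¹ *ᵥ fun b => (Jr b : ℂ)))) := h2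
        _ ≤ const114 d a * Real.exp (-(delta114 d a * distSite M y y')) * cutSupL n M (indCut n M y)
              * locNorm (Loc189.vec fun b => (Jr b : ℂ)) := h3
        _ ≤ const114 d a * Real.exp (-(delta114 d a * distSite M y y')) * 1
              * (Real.sqrt ((d : ℝ) ^ 3 * 3 ^ d) * supNormL n M (LocR.vec Jr : LocR n M).emb) := by
            gcongr
            · exact B5Prop11SettingModel.locNorm_nonneg _
            · exact h4
        _ = constZero d a * Real.exp (-(delta114 d a * distSite M y y')) * supNormL n M (LocR.vec Jr : LocR n M).emb := by
            unfold constZero; ring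
  | ten Jr => exact hRHS
  | ten2 Jr => exact hRHS

end Sup

/-! ## §3  The Hölder member (1.111), first entry, at `η = 1` -/

section Holder

variable {n : ℕ} [NeZero n] {M : Fin d → ℕ} [∀ μ, NeZero (M μ)] {a : ℝ}

omit [∀ μ, NeZero (M μ)] in
/-- at `η = 1` the fine distance in units is a natural number: a pair at distance `0 < |x − x′| ≤ 1` is at distance exactly `1`.
[cite: Balaban1984PropagatorsI, (1.109) p.35 («sup over x, x′ : |x − x′| ≤ 1»)] -/
theorem distU_eq_one_of (hn : n = 1) {z z' : Tor (fine n M)} (h0 : 0 < distU n M z z') (h1 : distU n M z z' ≤ 1) :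
    distU n M z z' = 1 := by
  subst hn
  unfold distU at *
  rw [Nat.cast_one, div_one] at *
  have h0' : 0 < (Finset.univ.sup (cdistF 1 M z z') : ℕ) := by exact_mod_cast h0
  have h1' : (Finset.univ.sup (cdistF 1 M z z') : ℕ) ≤ 1 := by exact_mod_cast h1
  have : (Finset.univ.sup (cdistF 1 M z z') : ℕ) = 1 := by omega
  rw [this, Nat.cast_one]

/-- `|ζ| ≤ ‖ζ‖_α + |ζ|` (the Hölder part is nonnegative). [cite: Balaban1984PropagatorsI, Prop. 1.2 (1.111) p.35] -/
theorem cutSupL_le_cutHL (α : ℝ) (ζ : Tor (fine n M) → ℝ) : cutSupL n M ζ ≤ cutHL n M α ζ := by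
  unfold cutHL LatticeNorms.holderSeminormB5
  have := holderSeminorm_nonneg α (fun b b' : Tor (fine n M) => True ∧ distU n M b b' ≤ 1) (distU n M) (fun _ _ => id)
    Finset.univ ζ
  linarith

/-- one value of the cut gradient field: `|ζ(z)(∇_νGJ)_μ(z)| ≤ (‖ζ‖_α + |ζ|)·O(1)e^{−δ₀|y−y′|}|J|` for `supp ζ ⊂ Δ̃(y)`, `supp J ⊂ Δ̃(y′)`
(the (1.110) entry `m = 1` at the points where `ζ ≠ 0`). [cite: Balaban1984PropagatorsI, Prop. 1.2 (1.110)–(1.111) p.35] -/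
theorem norm_smulT_grad_le (hn : n = 1) (ha : 0 < a) (α : ℝ) (Jr : Tor (fine n M) × Fin d → ℝ) (ζ : Tor (fine n M) → ℝ)
    {y y' : Tor M} (hζ : cutInL n M ζ y) (hJ : suppInL n M (LocR.vec Jr : LocR n M).emb y')
    (p : Fin d × (Tor (fine n M) × Fin d)) :
    ‖smulT n M ζ (grad n M ((DeltaA n M a)⁻¹ *ᵥ fun b => (Jr b : ℂ))) p.1 p.2‖
      ≤ cutHL n M α ζ * (constZero d a * Real.exp (-(delta114 d a * distSite M y y')) * supNormL n M (LocR.vec Jr : LocR n M).emb) := by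
  have hH : 0 ≤ cutHL n M α ζ := B5Prop12FieldsLattice.cutHL_nonneg α ζ
  have hE : 0 ≤ constZero d a * Real.exp (-(delta114 d a * distSite M y y')) * supNormL n M (LocR.vec Jr : LocR n M).emb := by
    have := constZero_nonneg d a
    have := B5Prop12FieldsLattice.supNormL_nonneg (LocR.vec Jr : LocR n M).emb
    positivity
  by_cases hz : ζ p.2.1 = 0
  · simp only [smulT, hz, Complex.ofReal_zero, zero_mul, norm_zero]
    positivity
  · have hmem : p.2.1 ∈ cubeT n M y := hζ _ hz
    have hp : p ∈ Finset.univ ×ˢ cubeB n M y :=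
      Finset.mem_product.mpr ⟨Finset.mem_univ _, Finset.mem_product.mpr ⟨hmem, Finset.mem_univ _⟩⟩
    have h1 := norm_le_supNorm (fun q : Fin d × (Tor (fine n M) × Fin d) =>
      grad n M ((DeltaA n M a)⁻¹ *ᵥ fun b => (Jr b : ℂ)) q.1 q.2) hp
    have h2 : supNorm (Finset.univ ×ˢ cubeB n M y)
        (fun q : Fin d × (Tor (fine n M) × Fin d) => grad n M ((DeltaA n M a)⁻¹ *ᵥ fun b => (Jr b : ℂ)) q.1 q.2)
        ≤ constZero d a * Real.exp (-(delta114 d a * distSite M y y')) * supNormL n M (LocR.vec Jr : LocR n M).emb :=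
      eL_one_le_one (d := d) hn ha (LocR.vec Jr) y y' hJ
    have h3 : |ζ p.2.1| ≤ cutHL n M α ζ := by
      refine le_trans ?_ (cutSupL_le_cutHL α ζ)
      have := norm_le_supNorm (S := Finset.univ) ζ (Finset.mem_univ p.2.1)
      rwa [Real.norm_eq_abs] at this
    simp only [smulT, norm_mul, Complex.norm_real, Real.norm_eq_abs]
    exact mul_le_mul h3 (h1.trans h2) (norm_nonneg _) hH

/-- **(1.111), FIRST ENTRY, AT `η = 1` FOR REAL VECTOR SOURCES**: `‖ζ∇GJ‖_α ≤ 2·O(1)e^{−δ₀|y−y′|}(‖ζ‖_α + |ζ|)|J|` for every `α`,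
`supp ζ ⊂ Δ̃(y)`, `supp J ⊂ Δ̃(y′)` (admissible pairs are at distance exactly `1`, so the quotient is a plain difference of two values).
[cite: Balaban1984PropagatorsI, Prop. 1.2 (1.111) p.35, (1.109) p.35] -/
theorem h1L_vec_le_one (hn : n = 1) (ha : 0 < a) (α : ℝ) (Jr : Tor (fine n M) × Fin d → ℝ) (ζ : Tor (fine n M) → ℝ)
    (y y' : Tor M) (hζ : cutInL n M ζ y) (hJ : suppInL n M (LocR.vec Jr : LocR n M).emb y') :
    h1L n M a (LocR.vec Jr : LocR n M).emb α ζ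
      ≤ 2 * constZero d a * Real.exp (-(delta114 d a * distSite M y y')) * cutHL n M α ζ
          * supNormL n M (LocR.vec Jr : LocR n M).emb := by
  show holderT n M α (smulT n M ζ (grad n M ((DeltaA n M a)⁻¹ *ᵥ fun b => (Jr b : ℂ)))) ≤ _
  unfold holderT LatticeNorms.holderSeminormB5
  have hB : 0 ≤ 2 * constZero d a * Real.exp (-(delta114 d a * distSite M y y')) * cutHL n M α ζ
      * supNormL n M (LocR.vec Jr : LocR n M).emb := by
    have := constZero_nonneg d a
    have := B5Prop12FieldsLattice.cutHL_nonneg (n := n) (M := M) α ζ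
    have := B5Prop12FieldsLattice.supNormL_nonneg (LocR.vec Jr : LocR n M).emb
    positivity
  refine holderSeminorm_le hB fun p _ p' _ hadm hpos => ?_
  dsimp only [id]
  have hd1 : distU n M p.2.1 p'.2.1 = 1 := distU_eq_one_of hn hpos hadm.2
  rw [hd1, Real.one_rpow, mul_one]
  have h1 := norm_smulT_grad_le (d := d) hn ha α Jr ζ hζ hJ p
  have h2 := norm_smulT_grad_le (d := d) hn ha α Jr ζ hζ hJ p'
  calc ‖smulT n M ζ (grad n M ((DeltaA n M a)⁻¹ *ᵥ fun b => (Jr b : ℂ))) p'.1 p'.2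
        - smulT n M ζ (grad n M ((DeltaA n M a)⁻¹ *ᵥ fun b => (Jr b : ℂ))) p.1 p.2‖
      ≤ ‖smulT n M ζ (grad n M ((DeltaA n M a)⁻¹ *ᵥ fun b => (Jr b : ℂ))) p'.1 p'.2‖
        + ‖smulT n M ζ (grad n M ((DeltaA n M a)⁻¹ *ᵥ fun b => (Jr b : ℂ))) p.1 p.2‖ := norm_sub_le _ _
    _ ≤ cutHL n M α ζ * (constZero d a * Real.exp (-(delta114 d a * distSite M y y')) * supNormL n M (LocR.vec Jr : LocR n M).emb)
        + cutHL n M α ζ * (constZero d a * Real.exp (-(delta114 d a * distSite M y y')) * supNormL n M (LocR.vec Jr : LocR n M).emb) :=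
        add_le_add h2 h1
    _ = _ := by ring

end Holder

end

end Literature.MathematicalPhysics.QuantumFieldTheory.BalabanImbrieJaffe1984to88.BIJ85Prop12BridgeZero
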